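import Literature.Topology.FourManifolds.TubeStageDiffeo
import HarnessLib

/-!
# The stage interface: readable shells and admissible untwist families

Topic `Literature/Topology/FourManifolds`; bookkeeping layer over `TubeStage.lean` /
`TubeStageDiffeo.lean` for the downward sweep of the smoothing of PD homeomorphisms (Munkres, Ann.
of Math. 72 (1960), §5; Campbell–D'Onofrio–Vítek (2026), §4).  The stage theorems
`contDiffAt_tubeStageMap` and `exists_hasFDerivAt_equiv_tubeStageMap` take some twenty
hypotheses; the sweep produces them from two independent sources — the FIRST READING of the current
map on the shell of the simplex (sector estimates and coface records) and the UNTWIST FAMILY built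
from the link diffeomorphism and `H_q`.  We name the two bundles as `Prop`-valued structures:

* `ShellReadable V r ρ K₀ C₁ T N` — everything the stage needs from the pair `(T, N)` read on
  the shell `{x ∈ V, r/4 ≤ ‖y‖ ≤ r}`: smoothness, non-vanishing at `r/4`, fibre injectivity,
  the source-defect bound with exponent constant `K₀`, radial transversality at `r/4`, the round
  radius bound `ρ ≤ ‖V‖`, and the flatten data with the cutoff constant `C₁`;
* `FamilyAdmissible V r R t₀ N Ψ lam` — everything it needs from the unit family `Ψ` and the pacing
  `λ`: smoothness off the zero section, agreement with the normalised link field for `s ≥ 2` and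
  with the isometry `R` at `s = 0`, unit norm, nondegenerate angular derivative, and the pacing
  plateaus;

and restate the two stage theorems over them (`ShellReadable.contDiffAt_tubeStageMap`,
`ShellReadable.exists_hasFDerivAt_equiv_tubeStageMap`), with the universal constants `K₀`
(`exists_stageExponentConst`) and `C₁` (`exists_deriv_flattenCutoff_bound`) threaded.  These
structures are predicates (no data, no named facts); they are the target of the first-reading
lemmas (sectors, records) and the source of the stage construction in the sweep.

## References

* J. R. Munkres, *Obstructions to the smoothing of piecewise-differentiable homeomorphisms*, Ann.
  of Math. (2) 72 (1960), 521–554, §5. [Munkres1960]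
* D. Campbell, L. D'Onofrio, T. Vítek, *Diffeomorphic approximation of piecewise affine
  homeomorphisms*, J. Geom. Anal. 36 (2026), §4. [CampbellDonofrioVitek2026]
-/

noncomputable section

open Set Function Metric Filter
open scoped Topology ContDiff RealInnerProductSpace

namespace Literature.Topology.FourManifolds

variable {E : Type*} [NormedAddCommGroup E] [NormedSpace ℝ E]
variable {F : Type*} [NormedAddCommGroup F] [InnerProductSpace ℝ F]

/-- **Readable shell.** The hypotheses of the stage theorems that concern the pair `(T, N)` (the
current map in the simplex's chart pair) on the shell `{x ∈ V, r/4 ≤ ‖y‖ ≤ r}`, with round radius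
`ρ`, exponent constant `K₀` and flatten-cutoff constant `C₁`. [folklore] -/
structure ShellReadable (V : Set E) (r ρ K₀ C₁ : ℝ) (T : E × F → E) (N : E × F → F) : Prop where
  /-- `N` is smooth on the closed shell `[r/4, r]`. -/
  contDiffAt_N : ∀ q : E × F, q.1 ∈ V → r / 4 ≤ ‖q.2‖ → ‖q.2‖ ≤ r → ContDiffAt ℝ ∞ N q
  /-- `T` is smooth on the flatten shell `[5r/8, r]`. -/
  contDiffAt_T : ∀ q : E × F, q.1 ∈ V → 5 * r / 8 ≤ ‖q.2‖ → ‖q.2‖ ≤ r → ContDiffAt ℝ ∞ T q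
  /-- `N` does not vanish on the link level `‖y‖ = r/4`. -/
  N_ne_zero : ∀ q : E × F, q.1 ∈ V → ‖q.2‖ = r / 4 → N q ≠ 0
  /-- The fibre derivative of `N` is injective on the shell. -/
  fibre_injective : ∀ q : E × F, q.1 ∈ V → r / 4 ≤ ‖q.2‖ → ‖q.2‖ ≤ r →
    ∀ w : F, fderiv ℝ N q (0, w) = 0 → w = 0
  /-- The source-form Euler defect is below `‖y‖/K₀` on the cone shell `[r/4, r/2]`. -/
  source_defect : ∀ q : E × F, q.1 ∈ V → r / 4 ≤ ‖q.2‖ → ‖q.2‖ ≤ r / 2 →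
    ∀ u : F, fderiv ℝ N q (0, u) = fderiv ℝ N q (0, q.2) - N q → K₀ * ‖u‖ < ‖q.2‖
  /-- Radial transversality of the link at `‖y‖ = r/4`. -/
  transversal : ∀ q : E × F, q.1 ∈ V → ‖q.2‖ = r / 4 →
    ∀ v : F, fderiv ℝ N q (0, v) = N q → 0 < ⟪v, q.2⟫
  /-- The round radius is below the link field everywhere off the zero section. -/
  rho_le : ∀ q : E × F, q.1 ∈ V → q.2 ≠ 0 → ρ ≤ ‖linkField N (r / 4) q‖
  /-- The flatten data on `[5r/8, r]`. -/
  flatten : ∀ q : E × F, q.1 ∈ V → 5 * r / 8 ≤ ‖q.2‖ → ‖q.2‖ ≤ r →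
    ∃ K δ C D : ℝ, 0 ≤ C ∧ 0 ≤ K ∧ 0 ≤ D ∧
      (∀ (v : E) (w : F), fderiv ℝ N q (v, w) = 0 → ‖w‖ ≤ K * ‖v‖) ∧
      (∀ v : E, ‖fderiv ℝ T q (v, 0) - v‖ ≤ δ * ‖v‖) ∧
      (∀ w : F, ‖fderiv ℝ T q (0, w)‖ ≤ C * ‖w‖) ∧ ‖T q - q.1‖ ≤ D ∧
      δ + (C + C₁ / r * D) * K < 1

/-- **Admissible untwist family.** The hypotheses of the stage theorems that concern the unit
family `Ψ` and the pacing `λ`, relative to `N` (link field at radius `r/4`), the final isometry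
`R` and the core radius `t₀`. [folklore] -/
structure FamilyAdmissible (V : Set E) (r : ℝ) (R : F →ₗᵢ[ℝ] F) (t₀ : ℝ) (N : E × F → F)
    (Ψ : ℝ → E × F → F) (lam : ℝ → ℝ) : Prop where
  /-- Joint smoothness off the zero section. -/
  contDiffAt : ∀ s : ℝ, ∀ q : E × F, q ∈ radialDomain V → ContDiffAt ℝ ∞ (uncurry Ψ) (s, q)
  /-- For `s ≥ 2` the family is the normalised link field. -/
  eq_link : ∀ s : ℝ, 2 ≤ s → ∀ q : E × F, q ∈ radialDomain V →
    Ψ s q = ‖linkField N (r / 4) q‖⁻¹ • linkField N (r / 4) q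
  /-- At `s = 0` the family is the isometry `R` of the unit direction. -/
  eq_zero : ∀ q : E × F, q ∈ radialDomain V → Ψ 0 q = R (‖q.2‖⁻¹ • q.2)
  /-- Unit norm. -/
  norm_eq_one : ∀ s : ℝ, ∀ q : E × F, q ∈ radialDomain V → ‖Ψ s q‖ = 1
  /-- Nondegenerate angular derivative. -/
  ker : ∀ s : ℝ, ∀ q : E × F, q ∈ radialDomain V → ∀ w : F, ⟪q.2, w⟫ = 0 →
    fderiv ℝ (uncurry Ψ) (s, q) (0, ((0 : E), w)) = 0 → w = 0
  /-- The pacing is smooth on `(0, ∞)`. -/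
  lam_contDiffAt : ∀ t : ℝ, 0 < t → ContDiffAt ℝ ∞ lam t
  /-- The pacing is `2` beyond `3r/32`. -/
  lam_two : ∀ t, 3 * r / 32 ≤ t → lam t = 2
  /-- The pacing is `0` below the core radius. -/
  lam_zero : ∀ t ≤ t₀, lam t = 0
  /-- The core radius is positive. -/
  t₀_pos : 0 < t₀

variable {V : Set E} {r ρ K₀ C₁ t₀ : ℝ} {T : E × F → E} {N : E × F → F} {Ψ : ℝ → E × F → F}
  {lam : ℝ → ℝ} {R : F →ₗᵢ[ℝ] F} {p : E × F}

/-- **Smoothness of the stage map** from a readable shell and an admissible family (restatement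
of `contDiffAt_tubeStageMap`). [folklore] -/
theorem ShellReadable.contDiffAt_tubeStageMap (hS : ShellReadable V r ρ K₀ C₁ T N)
    (hΨ : FamilyAdmissible V r R t₀ N Ψ lam) (hr : 0 < r) (hV : IsOpen V) (hp1 : p.1 ∈ V)
    (hpr : ‖p.2‖ < r) : ContDiffAt ℝ ∞ (tubeStageMap r ρ T N Ψ lam) p :=
  Literature.Topology.FourManifolds.contDiffAt_tubeStageMap hr hV hS.contDiffAt_N hS.contDiffAt_T hS.N_ne_zero
    hΨ.contDiffAt hΨ.eq_link hΨ.t₀_pos hΨ.eq_zero hΨ.lam_contDiffAt hΨ.lam_two hΨ.lam_zero hp1 hpr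

/-- **Invertible derivative of the stage map** from a readable shell (with the universal exponent
constant `K₀ ≥ 1` valid at this radius and the flatten-cutoff constant `C₁`) and an admissible
family with surjective `R` and positive round radius (restatement of
`exists_hasFDerivAt_equiv_tubeStageMap`). [folklore] -/
theorem ShellReadable.exists_hasFDerivAt_equiv_tubeStageMap [FiniteDimensional ℝ E] [FiniteDimensional ℝ F]
    (hS : ShellReadable V r ρ K₀ C₁ T N) (hΨ : FamilyAdmissible V r R t₀ N Ψ lam) (hr : 0 < r)
    (hV : IsOpen V) (hRs : Surjective R) (hK₀1 : 1 ≤ K₀)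
    (hK₀ : ∀ t : ℝ, 0 < t → t ≤ r / 2 → |1 - t * deriv (stagePacing r) t / stagePacing r t| ≤ K₀)
    (hρ : 0 < ρ) (hC₁ : ∀ t : ℝ, |deriv (flattenCutoff r) t| ≤ C₁ / r) (hp1 : p.1 ∈ V)
    (hpr : ‖p.2‖ < r) :
    ∃ L : (E × F) ≃L[ℝ] E × F, HasFDerivAt (tubeStageMap r ρ T N Ψ lam) (L : E × F →L[ℝ] E × F) p :=
  Literature.Topology.FourManifolds.exists_hasFDerivAt_equiv_tubeStageMap hr hV hS.contDiffAt_N hS.contDiffAt_T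
    hS.N_ne_zero hΨ.contDiffAt hΨ.eq_link hRs hΨ.t₀_pos hΨ.eq_zero hΨ.lam_contDiffAt hΨ.lam_two
    hΨ.lam_zero hS.fibre_injective hK₀1 hK₀ hS.source_defect hS.transversal hρ hS.rho_le hC₁ hS.flatten
    hΨ.norm_eq_one hΨ.ker hp1 hpr

/-- **The universal constants exist at once**: there are `K₀ ≥ 1` and `C₁ ≥ 0` valid for every
radius `r > 0` (packaging of `exists_stageExponentConst` and `exists_deriv_flattenCutoff_bound`).
[folklore] -/
theorem exists_stage_constants :
    ∃ K₀ C₁ : ℝ, 1 ≤ K₀ ∧ 0 ≤ C₁ ∧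
      (∀ r : ℝ, 0 < r → ∀ t : ℝ, 0 < t → t ≤ r / 2 → |1 - t * deriv (stagePacing r) t / stagePacing r t| ≤ K₀) ∧
      (∀ r : ℝ, 0 < r → ∀ t : ℝ, |deriv (flattenCutoff r) t| ≤ C₁ / r) := by
  obtain ⟨K₀, hK₀1, hK₀⟩ := exists_stageExponentConst
  obtain ⟨C₁, hC₁0, hC₁⟩ := exists_deriv_flattenCutoff_bound
  exact ⟨K₀, C₁, hK₀1, hC₁0, hK₀, hC₁⟩

/-- **Monotonicity in the constants**: a shell readable with exponent constant `K₀'` and flatten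
constant `C₁'` is readable with any smaller `K₀ ≤ K₀'` and `C₁ ≤ C₁'` (the two inequalities only
get easier). [folklore] -/
theorem ShellReadable.mono (hS : ShellReadable V r ρ K₀ C₁ T N) {K₀' C₁' : ℝ} (hK : K₀' ≤ K₀)
    (hC : C₁' ≤ C₁) (hr : 0 < r) : ShellReadable V r ρ K₀' C₁' T N where
  contDiffAt_N := hS.contDiffAt_N
  contDiffAt_T := hS.contDiffAt_T
  N_ne_zero := hS.N_ne_zero
  fibre_injective := hS.fibre_injective
  source_defect q hq h₁ h₂ u hu :=
    lt_of_le_of_lt (mul_le_mul_of_nonneg_right hK (norm_nonneg u)) (hS.source_defect q hq h₁ h₂ u hu)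
  transversal := hS.transversal
  rho_le := hS.rho_le
  flatten q hq h₁ h₂ := by
    obtain ⟨K, δ, C, D, hC0, hK0', hD0, hker, hTx, hTy, hD, hsmall⟩ := hS.flatten q hq h₁ h₂
    refine ⟨K, δ, C, D, hC0, hK0', hD0, hker, hTx, hTy, hD, lt_of_le_of_lt ?_ hsmall⟩
    have h1 : C₁' / r * D ≤ C₁ / r * D :=
      mul_le_mul_of_nonneg_right (div_le_div_of_nonneg_right hC hr.le) hD0
    nlinarith [mul_le_mul_of_nonneg_right (add_le_add_left h1 C) hK0']

/-- **Shrinking the base**: readability on `V` implies readability on any `V' ⊆ V`. [folklore] -/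
theorem ShellReadable.subset (hS : ShellReadable V r ρ K₀ C₁ T N) {V' : Set E} (hV' : V' ⊆ V) :
    ShellReadable V' r ρ K₀ C₁ T N where
  contDiffAt_N q hq := hS.contDiffAt_N q (hV' hq)
  contDiffAt_T q hq := hS.contDiffAt_T q (hV' hq)
  N_ne_zero q hq := hS.N_ne_zero q (hV' hq)
  fibre_injective q hq := hS.fibre_injective q (hV' hq)
  source_defect q hq := hS.source_defect q (hV' hq)
  transversal q hq := hS.transversal q (hV' hq)
  rho_le q hq := hS.rho_le q (hV' hq)
  flatten q hq := hS.flatten q (hV' hq)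

/-- **Shrinking the base** for families. [folklore] -/
theorem FamilyAdmissible.subset (hΨ : FamilyAdmissible V r R t₀ N Ψ lam) {V' : Set E} (hV' : V' ⊆ V) :
    FamilyAdmissible V' r R t₀ N Ψ lam where
  contDiffAt s q hq := hΨ.contDiffAt s q ⟨hV' hq.1, hq.2⟩
  eq_link s hs q hq := hΨ.eq_link s hs q ⟨hV' hq.1, hq.2⟩
  eq_zero q hq := hΨ.eq_zero q ⟨hV' hq.1, hq.2⟩
  norm_eq_one s q hq := hΨ.norm_eq_one s q ⟨hV' hq.1, hq.2⟩
  ker s q hq := hΨ.ker s q ⟨hV' hq.1, hq.2⟩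
  lam_contDiffAt := hΨ.lam_contDiffAt
  lam_two := hΨ.lam_two
  lam_zero := hΨ.lam_zero
  t₀_pos := hΨ.t₀_pos

end Literature.Topology.FourManifolds
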